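import Summits.QuantumFields.YangMills.Theorems.ColdStartUniversalityLatticeLangevinWindowCharFun
import Summits.QuantumFields.YangMills.Theorems.ColdStartUniversalityLatticeLangevinRegularFlow
import Mathlib.Probability.Distributions.Gaussian.Multivariate
import HarnessLib

/-!
# Route `ColdStartUniversality` (fixed-cut-off SZZ dynamics, sampler package): ★★★ THE FUNCTIONAL CENTRAL LIMIT THEOREM, FINITE-DIMENSIONAL
# DISTRIBUTIONS — the rescaled partial-sum process `s ↦ T^(−1/2)∫₀^(sT) Ĝ(U_r)dr` converges to `σ(G)·(Brownian motion)` in f.d.d.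

Helper file (seat `ym-line-csu-p1`, g35; `--supports stmt-QuantumFields-24809`).  For every coupling, every realising kernel family, EVERY strong
solution `U` of the SU(2) SZZ dynamics from EVERY deterministic start on ANY space, every continuous `|G| ≤ 1` (`Ĝ = G − μ_(β')G`,
`σ²(G) = 2∫₀^∞⟨Ĝ,κ_tĜ⟩_μ dt`) and every partition `0 = s₀ ≤ s₁ ≤ ⋯ ≤ s_m ≤ 1`, along every sequence `T_n → ∞` the random vectors of
WINDOW INCREMENTS

  `( T_n^(−1/2) ∫_(sᵢT_n, sᵢ₊₁T_n] Ĝ(U_r) dr )_(i<m)  ⇒  N(0, diag(σ²(G)(sᵢ₊₁ − sᵢ)))`   (★★★ `functionalCLT_fdd`)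

in distribution on `EuclideanSpace ℝ (Fin m)` (Mathlib `multivariateGaussian`, `TendstoInDistribution`): the increments of the partial-sum process
over disjoint windows are asymptotically INDEPENDENT centred Gaussians with variances `σ²(G)·|window|` — the finite-dimensional distributions
of `σ(G)·W` for a standard Brownian motion `W` (equivalently, by the continuous mapping theorem, the vector of values
`(T^(−1/2)∫₀^(sᵢT)Ĝ)_i` converges to `(σW_(sᵢ))_i`).  Proof: the Cramér–Wold step of file `…WindowCharFun`, Lévy's continuity theorem in
`ℝ^m` (`ProbabilityMeasure.tendsto_iff_tendsto_charFun`, `charFun_multivariateGaussian`), the regular flow and pathwise uniqueness.  Tightness —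
the invariance principle in `C[0,1]` — is not addressed.  THEOREMS ONLY, no definition, no sorry; [folklore] (Bhattacharya 1982, f.d.d. part).
HONEST FRAMING: fixed cut-off; `σ²(G)` depends on `L, β'`; `UniformColdStartMixing` (24809) is NOT restated; no crux, rung or summit statement is
proved; the Yang–Mills mass gap is NOT proved.
-/

set_option autoImplicit false

noncomputable section

namespace Summit.QuantumFields.YangMills.Theorems.ColdStartUniversality

open MeasureTheory ProbabilityTheory Filter Topology Set Matrix
open scoped NNReal ENNReal BigOperators
open Literature Literature.Probability.Process Literature.MathematicalPhysics.QuantumFieldTheory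
open Literature.MathematicalPhysics.QuantumLattice (fundamentalRep fundamentalLatticeRep continuous_fundamentalRep)

variable {L : ℕ} [NeZero L]

/-- ★★★ **Functional CLT for the cold-start SZZ sampler, finite-dimensional distributions.**  For every strong solution `U` from a
deterministic start, every continuous `|G| ≤ 1` and every partition `0 = s₀ ≤ ⋯ ≤ s_m ≤ 1`: the covariance `diag(σ²(sᵢ₊₁ − sᵢ))` is positive
semidefinite, and along every `T_n → ∞` the vector of window increments `(T_n^(−1/2)∫_(sᵢT_n,sᵢ₊₁T_n] Ĝ(U_r)dr)_(i<m)` converges in distribution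
to `N(0, diag(σ²(sᵢ₊₁ − sᵢ)))` — independent Brownian increments scaled by `σ = σ_(L,β')(G)` (fixed cut-off). [folklore] -/
theorem functionalCLT_fdd (L : ℕ) [NeZero L] (β' : ℝ)
    (κ : ℝ≥0 → Kernel (GaugeConfig 3 L (Matrix.specialUnitaryGroup (Fin 2) ℂ))
      (GaugeConfig 3 L (Matrix.specialUnitaryGroup (Fin 2) ℂ))) [∀ t, IsMarkovKernel (κ t)]
    (hreal : ∀ (t : ℝ≥0) (x : GaugeConfig 3 L (Matrix.specialUnitaryGroup (Fin 2) ℂ))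
        (Ω : Type) [MeasurableSpace Ω] (P : Measure Ω) [IsProbabilityMeasure P]
        (W : ℝ≥0 → Ω → (Edge 3 L × NoiseIdx 2 → ℝ)) (hW : IsFlatBrownian W P)
        (U : ℝ≥0 → Ω → GaugeConfig 3 L (Matrix.specialUnitaryGroup (Fin 2) ℂ)),
        (∀ ω, U 0 ω = x) →
        (latticeLangevinDynamics (fundamentalLatticeRep 2) β').IsSolution (fundamentalRep (Fin 2))
          hW.natFiltration P W U →
        κ t x = P.map (U t))
    (x : GaugeConfig 3 L (Matrix.specialUnitaryGroup (Fin 2) ℂ))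
    {Ω : Type} [MeasurableSpace Ω] {P : Measure Ω} [IsProbabilityMeasure P]
    {W : ℝ≥0 → Ω → (Edge 3 L × NoiseIdx 2 → ℝ)} (hW : IsFlatBrownian W P)
    {U : ℝ≥0 → Ω → GaugeConfig 3 L (Matrix.specialUnitaryGroup (Fin 2) ℂ)} (hU0 : ∀ ω, U 0 ω = x)
    (hU : (latticeLangevinDynamics (fundamentalLatticeRep 2) β').IsSolution (fundamentalRep (Fin 2)) hW.natFiltration P W U)
    {G : GaugeConfig 3 L (Matrix.specialUnitaryGroup (Fin 2) ℂ) → ℝ} (hGc : Continuous G) (hG1 : ∀ z, |G z| ≤ 1)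
    {σ2 : ℝ} (hσ2 : σ2 = 2 * ∫ t in Ioi (0 : ℝ),
        (∫ y, (G y - ∫ z, G z ∂(wilsonMeasure (d := 3) (L := L) (fundamentalRep (Fin 2)) β')) *
          (∫ z, (G z - ∫ z', G z' ∂(wilsonMeasure (d := 3) (L := L) (fundamentalRep (Fin 2)) β')) ∂(κ t.toNNReal y))
          ∂(wilsonMeasure (d := 3) (L := L) (fundamentalRep (Fin 2)) β')))
    {m : ℕ} (s : ℕ → ℝ) (hs0 : s 0 = 0) (hsmono : Monotone s) (hs1 : s m ≤ 1) :
    (Matrix.diagonal fun i : Fin m => σ2 * (s ((i : ℕ) + 1) - s i)).PosSemidef ∧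
    ∀ (Ω' : Type) [MeasurableSpace Ω'] (P' : Measure Ω') [IsProbabilityMeasure P'] (Y : Ω' → EuclideanSpace ℝ (Fin m)),
      HasLaw Y (multivariateGaussian 0 (Matrix.diagonal fun i : Fin m => σ2 * (s ((i : ℕ) + 1) - s i))) P' →
      ∀ (Tn : ℕ → ℝ), Tendsto Tn atTop atTop →
      TendstoInDistribution (fun (n : ℕ) ω => (WithLp.toLp 2 fun i : Fin m => (Real.sqrt (Tn n))⁻¹ *
        ∫ r in Ioc (s i * Tn n) (s ((i : ℕ) + 1) * Tn n),
          (G (U r.toNNReal ω) - ∫ z, G z ∂(wilsonMeasure (d := 3) (L := L) (fundamentalRep (Fin 2)) β')) : EuclideanSpace ℝ (Fin m)))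
        atTop Y (fun _ => P) P' := by
  classical
  haveI := secondCountableTopology_su2
  haveI := borelSpace_config L
  set μ : Measure (GaugeConfig 3 L (Matrix.specialUnitaryGroup (Fin 2) ℂ)) :=
    wilsonMeasure (d := 3) (L := L) (fundamentalRep (Fin 2)) β' with hμ
  set mG : ℝ := ∫ z, G z ∂μ with hmG
  set Gh : GaugeConfig 3 L (Matrix.specialUnitaryGroup (Fin 2) ℂ) → ℝ := fun z => G z - mG with hGh
  have hGhm : Measurable Gh := hGc.measurable.sub measurable_const
  have hσ0 : 0 ≤ σ2 := by rw [hσ2]; exact mul_nonneg (by norm_num) (greenKubo_nonneg L β' κ hreal hGc hG1)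
  /- ### 1. The limiting covariance is positive semidefinite -/
  have hPSD : (Matrix.diagonal fun i : Fin m => σ2 * (s ((i : ℕ) + 1) - s i)).PosSemidef := by
    refine Matrix.PosSemidef.of_dotProduct_mulVec_nonneg ?_ fun v => ?_
    · ext i j
      simp only [Matrix.conjTranspose_apply, Matrix.diagonal_apply, star_trivial]
      by_cases h : i = j
      · subst h; simp
      · rw [if_neg h, if_neg (Ne.symm h)]
    · rw [star_trivial]
      simp only [dotProduct, Matrix.mulVec_diagonal]
      exact Finset.sum_nonneg fun i _ => by
        have h1 : 0 ≤ s ((i : ℕ) + 1) - s i := sub_nonneg.2 (hsmono (Nat.le_succ _))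
        have : v i * (σ2 * (s ((i : ℕ) + 1) - s i) * v i) = σ2 * (s ((i : ℕ) + 1) - s i) * v i ^ 2 := by ring
        rw [this]; positivity
  refine ⟨hPSD, fun Ω' _ P' _ Y hY Tn hTn => ?_⟩
  /- ### 2. Regular flow; the window vectors along `V` -/
  obtain ⟨V, -, hV, hVprog, -, -, -⟩ := exists_regularFlow L β' hW
  have hprog : ∀ i : ℝ≥0, Measurable[@Prod.instMeasurableSpace (Set.Iic i) Ω inferInstance (hW.natFiltration i)]
      (fun q : Set.Iic i × Ω => V x q.1 q.2) := fun i =>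
    (hVprog i).comp (measurable_fst.prodMk (measurable_const.prodMk measurable_snd))
  have hae : ∀ᵐ ω ∂P, ∀ t, U t ω = V x t ω := latticeLangevin_pathwise_unique hW β' x hU0 (hV x).1 hU (hV x).2
  have hpathm : Measurable fun p : Ω × ℝ => V x p.2.toNNReal p.1 :=
    measurable_uncurry_of_prog (Z := V x) (fun n : ℕ => hW.natFiltration n) (fun n => hW.natFiltration.le n) (fun n => hprog n)
  have hIm : ∀ lo hi : ℝ, Measurable fun ω => ∫ r in Ioc lo hi, Gh (V x r.toNNReal ω) := fun lo hi => by
    have h1 : Measurable (Function.uncurry fun (ω : Ω) (r : ℝ) => Gh (V x r.toNNReal ω)) := hGhm.comp hpathm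
    exact (h1.stronglyMeasurable.integral_prod_right' (ν := volume.restrict (Ioc lo hi))).measurable
  set XV : ℕ → Ω → EuclideanSpace ℝ (Fin m) := fun n ω => WithLp.toLp 2 fun i : Fin m => (Real.sqrt (Tn n))⁻¹ *
    ∫ r in Ioc (s i * Tn n) (s ((i : ℕ) + 1) * Tn n), Gh (V x r.toNNReal ω) with hXV
  have hXVm : ∀ n, Measurable (XV n) := fun n =>
    (WithLp.measurable_toLp 2 _).comp (measurable_pi_lambda _ fun i => (hIm _ _).const_mul _)
  have hXU : ∀ n, (fun ω => (WithLp.toLp 2 fun i : Fin m => (Real.sqrt (Tn n))⁻¹ *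
      ∫ r in Ioc (s i * Tn n) (s ((i : ℕ) + 1) * Tn n), (G (U r.toNNReal ω) - mG) : EuclideanSpace ℝ (Fin m))) =ᵐ[P] XV n := fun n => by
    filter_upwards [hae] with ω hω
    simp only [hXV, hGh]
    congr 1
    funext i
    have : (fun r : ℝ => G (U r.toNNReal ω) - mG) = fun r : ℝ => G (V x r.toNNReal ω) - mG := funext fun r => by rw [hω]
    rw [this]
  /- ### 3. Characteristic functions (Cramér–Wold, file `…WindowCharFun`) -/
  have hchar : ∀ xv : EuclideanSpace ℝ (Fin m), Tendsto (fun n => ∫ ω, Complex.exp (((inner ℝ (XV n ω) xv : ℝ) : ℂ) * Complex.I) ∂P) atTop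
      (𝓝 (Complex.exp (-(((xv.ofLp ⬝ᵥ ((Matrix.diagonal fun i : Fin m => σ2 * (s ((i : ℕ) + 1) - s i)) *ᵥ xv.ofLp)) / 2 : ℝ) : ℂ)))) := by
    intro xv
    have hT := tendsto_charFun_windowIncrements_of_prog L β' κ hreal x hW (hV x).1 (hV x).2 hprog hGc hG1 hσ2 s hs0 hsmono hs1 xv.ofLp
    have hquad : xv.ofLp ⬝ᵥ ((Matrix.diagonal fun i : Fin m => σ2 * (s ((i : ℕ) + 1) - s i)) *ᵥ xv.ofLp) =
        σ2 * ∑ i : Fin m, xv.ofLp i ^ 2 * (s ((i : ℕ) + 1) - s i) := by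
      simp only [dotProduct, Matrix.mulVec_diagonal, Finset.mul_sum]
      exact Finset.sum_congr rfl fun i _ => by ring
    have hinner : ∀ n ω, inner ℝ (XV n ω) xv = ∑ i : Fin m, xv.ofLp i * ((Real.sqrt (Tn n))⁻¹ *
        ∫ r in Ioc (s i * Tn n) (s ((i : ℕ) + 1) * Tn n), Gh (V x r.toNNReal ω)) := fun n ω => by
      simp only [hXV, PiLp.inner_apply, RCLike.inner_apply, conj_trivial]
    rw [hquad]
    simp_rw [hinner]
    exact hT.comp hTn
  /- ### 4. Lévy in `ℝ^m` and transfer to `U` -/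
  have hVd : TendstoInDistribution XV atTop Y (fun _ => P) P' := by
    refine ⟨fun n => (hXVm n).aemeasurable, hY.aemeasurable, ?_⟩
    refine ProbabilityMeasure.tendsto_iff_tendsto_charFun.2 fun xv => ?_
    have hφ : Measurable fun v : EuclideanSpace ℝ (Fin m) => Complex.exp (((inner ℝ v xv : ℝ) : ℂ) * Complex.I) :=
      ((Complex.measurable_ofReal.comp (continuous_id.inner continuous_const).measurable).mul_const _).cexp
    have hN : ∀ n, charFun (P.map (XV n)) xv = ∫ ω, Complex.exp (((inner ℝ (XV n ω) xv : ℝ) : ℂ) * Complex.I) ∂P := fun n => by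
      rw [charFun_apply, integral_map (hXVm n).aemeasurable hφ.aestronglyMeasurable]
    have hlim : charFun (P'.map Y) xv =
        Complex.exp (-(((xv.ofLp ⬝ᵥ ((Matrix.diagonal fun i : Fin m => σ2 * (s ((i : ℕ) + 1) - s i)) *ᵥ xv.ofLp)) / 2 : ℝ) : ℂ)) := by
      rw [hY.map_eq, charFun_multivariateGaussian hPSD]
      congr 1
      simp only [inner_zero_right, Complex.ofReal_zero, zero_mul, zero_sub]
      push_cast
      ring
    simp only [ProbabilityMeasure.coe_mk]
    rw [hlim]
    simp_rw [hN]
    exact hchar xv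
  exact hVd.congr (fun n => (hXU n).symm) (ae_eq_refl _)

end Summit.QuantumFields.YangMills.Theorems.ColdStartUniversality

end
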